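import Mathlib
import HarnessLib

/-!
# Stub `stub_farFieldNontrivial` — crux `PointSink.ConeDesingularisation` (stmt-AnomalousDissipation-19034), line `Sketch`

A point-flux cone `V` on `ℝ³ ∖ {0}`, locally `L²` off the origin, whose radial energy-flux density
`(½|V|² + P)(V·x)/|x|²` has non-zero integral over the fundamental shell `{1 < |x| < λ}`, is
non-trivial in `L²` on that shell: `0 < ∫_{1<|x|<λ} |V|²`.

Proof. The closed shell `{1 ≤ |x| ≤ λ}` is compact and avoids the origin, so `|V|²` is integrable
on it, hence on the open shell. The open-shell integral of `|V|²` is `≥ 0`; were it `0`, then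
`V = 0` a.e. on the shell, so the flux density vanishes a.e. there and its integral is `0`,
contradicting the hypothesis.
-/

noncomputable section

-- `Summit.<Summit>.<Problem>`: single-conjunct summit, the duplicate namespace is mandated (CONVENTIONS §2).
set_option linter.dupNamespace false

namespace Summit.AnomalousDissipation.AnomalousDissipation.Theorems

open MeasureTheory Filter Topology Set

/-- Points / velocity values of `ℝ³`. -/
local notation "E³" => EuclideanSpace ℝ (Fin 3)

/-- The closed spherical shell `{1 ≤ ‖x‖ ≤ lam}` in `ℝ³` is compact. -/
theorem coneShell_isCompact_closedShell (lam : ℝ) :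
    IsCompact {x : E³ | 1 ≤ ‖x‖ ∧ ‖x‖ ≤ lam} := by
  refine Metric.isCompact_of_isClosed_isBounded ?_ ?_
  · exact (isClosed_Icc (a := (1 : ℝ)) (b := lam)).preimage continuous_norm
  · refine (Metric.isBounded_closedBall (x := (0 : E³)) (r := lam)).subset ?_
    intro x hx
    simpa using hx.2

/-- The closed spherical shell `{1 ≤ ‖x‖ ≤ lam}` avoids the origin. -/
theorem coneShell_closedShell_subset_ne_zero (lam : ℝ) :
    {x : E³ | 1 ≤ ‖x‖ ∧ ‖x‖ ≤ lam} ⊆ {x : E³ | x ≠ 0} := by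
  intro x hx h0
  have h1 : (1 : ℝ) ≤ ‖x‖ := hx.1
  rw [h0, norm_zero] at h1
  exact absurd h1 (by norm_num)

/-- A function locally integrable off the origin is integrable on the open shell
`{1 < ‖x‖ < lam}`. -/
theorem coneShell_integrableOn_shell {f : E³ → ℝ} (lam : ℝ)
    (hf : LocallyIntegrableOn f {x : E³ | x ≠ 0} volume) :
    IntegrableOn f {x : E³ | 1 < ‖x‖ ∧ ‖x‖ < lam} volume :=
  (hf.integrableOn_compact_subset (coneShell_closedShell_subset_ne_zero lam)
    (coneShell_isCompact_closedShell lam)).mono_set fun _ hx => ⟨hx.1.le, hx.2.le⟩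

/-- **Stub `stub_farFieldNontrivial`.** A cone with non-zero radial energy-flux integral on the
fundamental shell `1 < |x| < λ` is non-trivial there in `L²`: if `∫_{shell} |V|² = 0` then (local
integrability off the origin, the closed shell being a compact subset of `ℝ³ ∖ {0}`) `V = 0` a.e. on
the shell, so the flux density vanishes a.e. and its integral is `0`. -/
theorem stub_farFieldNontrivial :
    ∀ (lam : ℝ) (V : E³ → E³) (P : E³ → ℝ), 1 < lam →
      LocallyIntegrableOn (fun x => ‖V x‖ ^ 2) {x : E³ | x ≠ 0} volume →
      (∫ x in {x : E³ | 1 < ‖x‖ ∧ ‖x‖ < lam}, (‖V x‖ ^ 2 / 2 + P x) * (inner ℝ (V x) x / ‖x‖ ^ 2)) ≠ 0 →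
      0 < ∫ x in {x : E³ | 1 < ‖x‖ ∧ ‖x‖ < lam}, ‖V x‖ ^ 2 := by
  intro lam V P _ hVloc hflux
  have hint : IntegrableOn (fun x => ‖V x‖ ^ 2) {x : E³ | 1 < ‖x‖ ∧ ‖x‖ < lam} volume :=
    coneShell_integrableOn_shell lam hVloc
  have hnn : 0 ≤ᵐ[volume.restrict {x : E³ | 1 < ‖x‖ ∧ ‖x‖ < lam}] fun x => ‖V x‖ ^ 2 :=
    Eventually.of_forall fun x => sq_nonneg _
  have hge : 0 ≤ ∫ x in {x : E³ | 1 < ‖x‖ ∧ ‖x‖ < lam}, ‖V x‖ ^ 2 :=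
    integral_nonneg fun x => sq_nonneg _
  rcases hge.lt_or_eq with h | h
  · exact h
  · exfalso
    apply hflux
    have hae : (fun x => ‖V x‖ ^ 2) =ᵐ[volume.restrict {x : E³ | 1 < ‖x‖ ∧ ‖x‖ < lam}] 0 :=
      (setIntegral_eq_zero_iff_of_nonneg_ae hnn hint).1 h.symm
    calc ∫ x in {x : E³ | 1 < ‖x‖ ∧ ‖x‖ < lam}, (‖V x‖ ^ 2 / 2 + P x) * (inner ℝ (V x) x / ‖x‖ ^ 2)
        = ∫ x in {x : E³ | 1 < ‖x‖ ∧ ‖x‖ < lam}, (0 : ℝ) := by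
          refine integral_congr_ae (hae.mono fun x hx => ?_)
          have hVx : V x = 0 := by simpa using hx
          simp [hVx]
      _ = 0 := integral_zero _ _

end Summit.AnomalousDissipation.AnomalousDissipation.Theorems

end
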